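import Summits.QuantumFields.BalabanUV.T4Continuum.Support.ShellMeasureLandauHolonomyContinuity
import Literature.Analysis.Complex.OsgoodSeparate

/-!
# `T4Continuum.ShellMeasureLandauHolonomyAnalytic` — JOINT HOLOMORPHY OF THE CANONICAL SOLUTION, OF THE LANDAU
# CORRECTION AND OF THE DEFINED LANDAU HOLONOMY IN FINITELY MANY COMPLEX PARAMETERS (Osgood's lemma on top of the
# one-parameter analyticity and the parametric continuity)
(cell `pub-balaban`, sub-cell `t4`, spine estimate NE7c (node U5b); NE7c formalisation swarm, crew seat
`b2b-balaban-t4-ne7c-formalise-leaf-05` gen 4 — companion of `ShellMeasureLandauHolonomyContinuity` (p212890); imports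
that file and the tree's Osgood lemma `Literature.Analysis.Complex.OsgoodSeparate` ONLY; 0 def, 0 `def … : Prop`, 0 sorry)

HONEST FRAMING.  Finite four-torus programme, rung (B)+1 only — NOT infinite volume, NOT a mass gap, NOT the Clay
problem, NOT summit progress; (B), `BetaPertHyp`, (B^μ) not consumed.  NE7c (`T4IndicatorShell.ShellWeightBound`) is
NOT PRINTED and NOT PROVED; «NE7c ⇐ the named binders».  Nothing printed in [Balaban1985Variational] is asserted: (P2),
(P4), (118)/(121), (44)+[4] Prop. 7, (46), (54), (75)/(103) are TYPED HYPOTHESES, by name, as in the imported files.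

WHY THIS FILE.  The tree's reproduction of B11 Prop. 6 (`B11Prop6Scheme.solution_analytic`) and of Sect. C / B13
(1.13) (`B13Contraction113.analytic_fixedPoint_113`) type «the solution is an analytic function of 𝔄» for ONE complex
parameter at a time; `B11Prop6Scheme`'s header lists «joint analyticity in several parameters» as NOT typed.  On the
finite lattice the data live in a finite-dimensional complex space, where JOINT holomorphy = continuity + separate
holomorphy (Osgood's lemma, tree `Literature.Analysis.Complex.SCV.differentiableOn_of_continuousOn_of_separately`).
The continuity is `ShellMeasureLandauHolonomyContinuity.continuousOn_solAt` / `continuousOn_corrAt` (contraction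
principle with a parameter); the separate holomorphy is the one-parameter clause BY NAME.  Hence:
* §1 `differentiableOn_solAt` — for data `(Jof z, 𝔄of z)` holomorphic on an open `U ⊆ ℂᵐ` with `‖Jof z‖ ≤ j`,
  `‖𝔄of z‖ < a`, the canonical solution `z ↦ solAt 𝒢 Λ W ε₄ (Jof z) (𝔄of z)` is HOLOMORPHIC on `U` (Fréchet, jointly).
* §2 `differentiableOn_corrAt`, `differentiableOn_landauExp` — for `Y` holomorphic on `U` with `‖Y z‖ < ε`, the
  canonical Landau correction `z ↦ corrAt C ι H (4C₂ε²) (Y z)` and the Landau exponent `Y − H D(Y)` are HOLOMORPHIC on `U`.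
* §3 `differentiableOn_holOf` — words of exponentials of read-outs of a holomorphic exponent field are holomorphic.
* §4 `differentiableOn_landauHol_polydisc` — THE HOLONOMY FIELD OF `ShellMeasureLandauHolonomyChart` §3, read at COMPLEX
  chart points, `z ↦ holOf ℓs (landauExp C ι H (4C₂(ε₄+B₀b)²) ∘ (solAt 𝒢 0 W𝒱 ε₄ 0 (H₁ (Φ ·)) + H₁ (Φ ·))) z`, is
  HOLOMORPHIC on the polydisc `‖z‖ < r_Φ` under 7″'s own data binders; the real-chart holonomy of 7″ is its restriction
  along `cplx` (`landauHol_chart_eq`).  This is the (1.31)/(2.17)-TYPE statement «the block configuration is an analytic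
  function of the (complexified) field on the window's polydisc» for OUR DEFINED object — not for Bałaban's
  minimiser (the binders are not discharged).
Nothing displayed moves; NE7c NOT PROVED; spine PROVED 0/9.  HONEST DEPENDENCY (cell): continuum YM on T⁴ ⇐
BetaPertH ∧ nine spine estimates (0/9 proved); BetaPertH ⇐ (D1) ∧ (D4) ∧ CAP+tail; G-an2-4 gates asym, D1 and
NE2/3/4.
-/

noncomputable section

open Set Metric NormedSpace Function

namespace Summit.QuantumFields.BalabanUV.T4Continuum.ShellMeasureLandauHolonomyAnalytic

open Literature.MathematicalPhysics.QuantumFieldTheory.Balaban1983to89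
open B11Prop6Scheme (mapT Prop4Hyp norm_arg_lt solution_analytic existsUnique_solution)
open B13Contraction113 (QuadAnalytic analytic_fixedPoint_113)
open ShellMeasureWilsonWords (wordExp wordExp_nil wordExp_cons)
open ShellMeasureLandauFixedPoint (quadAnalytic_of_frechet)
open ShellMeasureLandauHolonomy (solAt corrAt landauExp solAt_spec solAt_eq_of_unique corrAt_eq_of_unique)
open ShellMeasureLandauHolonomyChart (holOf cplx holOf_apply)
open ShellMeasureLandauHolonomyContinuity (continuousOn_solAt continuousOn_corrAt)
open Literature.Analysis.Complex.SCV (differentiableOn_of_continuousOn_of_differentiableOn_update)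

variable {𝒴 𝒴' 𝒳 𝒵 : Type*} [NormedAddCommGroup 𝒴] [NormedSpace ℂ 𝒴] [NormedAddCommGroup 𝒴'] [NormedSpace ℂ 𝒴']
  [NormedAddCommGroup 𝒳] [NormedSpace ℂ 𝒳] [NormedAddCommGroup 𝒵] [NormedSpace ℂ 𝒵]

omit [NormedAddCommGroup 𝒴] [NormedSpace ℂ 𝒴] [NormedAddCommGroup 𝒴'] [NormedSpace ℂ 𝒴'] [NormedAddCommGroup 𝒳]
  [NormedSpace ℂ 𝒳] [NormedAddCommGroup 𝒵] [NormedSpace ℂ 𝒵] in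
/-- the coordinate slice `t ↦ (z with zᵢ := t)` is an entire (affine) map and its trace on an open set is open.
[folklore] -/
theorem slice_open_differentiable {m : ℕ} {U : Set (Fin m → ℂ)} (hU : IsOpen U) (z : Fin m → ℂ) (i : Fin m) :
    IsOpen {t : ℂ | Function.update z i t ∈ U} ∧ Differentiable ℂ (Function.update z i) :=
  have hd : Differentiable ℂ (Function.update z i) := fun t => (hasFDerivAt_update z t).differentiableAt
  ⟨hU.preimage hd.continuous, hd⟩

/-! ## §1 The canonical solution of B11 Prop. 6's scheme is jointly holomorphic in finitely many parameters -/

section Scheme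

variable [CompleteSpace 𝒴] {𝒢 : 𝒵 →L[ℂ] 𝒴} {Λ : 𝒴 →L[ℂ] 𝒴} {W : 𝒴 → 𝒵} {B₀ θ C₄ a₃ : ℝ}

omit [NormedAddCommGroup 𝒴'] [NormedSpace ℂ 𝒴'] [NormedAddCommGroup 𝒳] [NormedSpace ℂ 𝒳] in
/-- **THE SOLUTION OF B11 PROP. 6's SCHEME IS A (JOINTLY) HOLOMORPHIC FUNCTION OF FINITELY MANY COMPLEX PARAMETERS.**
Under (P2) `h𝒢`/`hΛ`, (P4) `hW`, the numbers (118)/(121): for data `Jof`, `𝔄of` holomorphic on an open `U ⊆ ℂᵐ` with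
`‖Jof z‖ ≤ j`, `‖𝔄of z‖ < a` there, `z ↦ solAt 𝒢 Λ W ε₄ (Jof z) (𝔄of z)` is complex (Fréchet-)differentiable on `U`.
Proof: Osgood's lemma (`Literature.Analysis.Complex.SCV.differentiableOn_of_continuousOn_of_differentiableOn_update`)
from the parametric continuity `ShellMeasureLandauHolonomyContinuity.continuousOn_solAt` and, on every coordinate
slice, the one-parameter analyticity `B11Prop6Scheme.solution_analytic` identified with `solAt` by uniqueness in the
ball.  (Prop. 6's «the solution is an analytic function of 𝔄», [Balaban1985Variational] p. 296, in its
finite-dimensional joint form; the tree had the one-parameter form only.) [folklore] -/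
theorem differentiableOn_solAt (h𝒢 : ∀ f, ‖𝒢 f‖ ≤ B₀ * ‖f‖) (hΛ : ∀ Y, ‖Λ Y‖ ≤ θ * ‖Y‖)
    (hW : Prop4Hyp W C₄ a₃) (hB₀ : 0 ≤ B₀) (hC₄ : 0 ≤ C₄) (hθ : 0 ≤ θ) {j a ε₄ : ℝ} (hε₄ : 0 ≤ ε₄)
    (hdom : 2 * (ε₄ + a) ≤ a₃) (hself : B₀ * j + θ * (ε₄ + a) + B₀ * C₄ * (ε₄ + a) ^ 2 ≤ ε₄)
    (hcontr : θ + 4 * B₀ * C₄ * (ε₄ + a) < 1) {m : ℕ} {U : Set (Fin m → ℂ)} (hU : IsOpen U)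
    {Jof : (Fin m → ℂ) → 𝒵} {𝔄of : (Fin m → ℂ) → 𝒴} (hJd : DifferentiableOn ℂ Jof U)
    (h𝔄d : DifferentiableOn ℂ 𝔄of U) (hJ : ∀ z ∈ U, ‖Jof z‖ ≤ j) (h𝔄 : ∀ z ∈ U, ‖𝔄of z‖ < a) :
    DifferentiableOn ℂ (fun z => solAt 𝒢 Λ W ε₄ (Jof z) (𝔄of z)) U := by
  refine differentiableOn_of_continuousOn_of_differentiableOn_update hU ?_ fun z _ i => ?_
  · have h := (continuousOn_solAt h𝒢 hΛ hW hB₀ hC₄ hθ hε₄ hdom hself hcontr).comp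
      (hJd.continuousOn.prodMk h𝔄d.continuousOn) fun z hz => ⟨hJ z hz, h𝔄 z hz⟩
    exact h
  · obtain ⟨hV, hupd⟩ := slice_open_differentiable hU z i
    have hJd' : DifferentiableOn ℂ (fun t => Jof (Function.update z i t)) {t : ℂ | Function.update z i t ∈ U} :=
      hJd.comp hupd.differentiableOn fun t ht => ht
    have h𝔄d' : DifferentiableOn ℂ (fun t => 𝔄of (Function.update z i t)) {t : ℂ | Function.update z i t ∈ U} :=
      h𝔄d.comp hupd.differentiableOn fun t ht => ht
    obtain ⟨Xs, hXd, hXs⟩ := solution_analytic h𝒢 hΛ hW hB₀ hC₄ hθ hε₄ hdom hself hcontr hV hJd' h𝔄d'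
      (fun t ht => hJ _ ht) (fun t ht => h𝔄 _ ht)
    refine hXd.congr fun t ht => ?_
    exact solAt_eq_of_unique (hXs t ht).1 (hXs t ht).2.1 (hXs t ht).2.2

end Scheme

/-! ## §2 The Landau correction and the Landau exponent are jointly holomorphic -/

section Corr

variable [CompleteSpace 𝒳]

omit [NormedAddCommGroup 𝒵] [NormedSpace ℂ 𝒵] in
/-- **THE LANDAU CORRECTION ALONG A HOLOMORPHIC FAMILY ON ANY OPEN SET OF ONE COMPLEX PARAMETER** — the open-set form
of `ShellMeasureLandauFixedPoint.landauCorrection_along` (there: discs): `B13Contraction113.analytic_fixedPoint_113`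
BY NAME, its `han` discharged from the Fréchet analyticity `hCd` ((44)+[4] Prop. 7 TYPE). [folklore] -/
theorem landauCorrection_on {C : 𝒴' → 𝒳} {C₂ R : ℝ} (hC₂ : 0 ≤ C₂)
    (hCq : ∀ Z : 𝒴', ‖Z‖ < R → ‖C Z‖ ≤ C₂ * ‖Z‖ ^ 2) (hCd : DifferentiableOn ℂ C (ball 0 R))
    (ι : 𝒴 →L[ℂ] 𝒴') (hι : ∀ Y, ‖ι Y‖ ≤ ‖Y‖) (H : 𝒳 →L[ℂ] 𝒴) {B₀ : ℝ} (hB₀ : 0 ≤ B₀)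
    (hH : ∀ X, ‖H X‖ ≤ B₀ * ‖X‖) {ε : ℝ} (hq : 9 * C₂ * B₀ * ε < 1) (hRC : 3 * ε ≤ R)
    {V : Set ℂ} (hV : IsOpen V) {Y : ℂ → 𝒴} (hYd : DifferentiableOn ℂ Y V) (hY : ∀ σ ∈ V, ‖Y σ‖ < ε) :
    ∃ Dc : ℂ → 𝒳, DifferentiableOn ℂ Dc V ∧ ∀ σ ∈ V,
      Dc σ ∈ closedBall (0 : 𝒳) (4 * C₂ * ε ^ 2) ∧ C (ι (Y σ) - ι (H (Dc σ))) = Dc σ ∧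
      (∀ X' ∈ closedBall (0 : 𝒳) (4 * C₂ * ε ^ 2), C (ι (Y σ) - ι (H X')) = X' → X' = Dc σ) ∧
      ‖Dc σ‖ ≤ 4 * C₂ * ‖ι (Y σ)‖ ^ 2 := by
  have hHop : ∀ σ ∈ V, ∀ X : 𝒳, ‖((ι.comp H : 𝒳 →L[ℂ] 𝒴') : 𝒳 →ₗ[ℂ] 𝒴') X‖ ≤ B₀ * ‖X‖ :=
    fun σ _ X => (hι _).trans (hH X)
  have hA : ∀ σ ∈ V, ‖ι (Y σ)‖ < ε := fun σ hσ => (hι _).trans_lt (hY σ hσ)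
  have han : ∀ g : ℂ → 𝒳, DifferentiableOn ℂ g V → MapsTo g V (closedBall (0 : 𝒳) (4 * C₂ * ε ^ 2)) →
      DifferentiableOn ℂ (fun σ => C (ι (Y σ) - ((ι.comp H : 𝒳 →L[ℂ] 𝒴') : 𝒳 →ₗ[ℂ] 𝒴') (g σ))) V := by
    intro g hg hgm
    have hinner : DifferentiableOn ℂ (fun σ => ι (Y σ) - ι (H (g σ))) V :=
      (ι.differentiable.comp_differentiableOn hYd).sub ((ι.comp H).differentiable.comp_differentiableOn hg)
    have hinto : MapsTo (fun σ => ι (Y σ) - ι (H (g σ))) V (ball (0 : 𝒴') R) := by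
      intro σ hσ
      have hε : 0 < ε := (norm_nonneg _).trans_lt (hY σ hσ)
      have hgσ : ‖g σ‖ ≤ 4 * C₂ * ε ^ 2 := mem_closedBall_zero_iff.1 (hgm hσ)
      have hR2 : 4 * C₂ * B₀ * ε ≤ 1 := by nlinarith
      have hHg : ‖ι (H (g σ))‖ ≤ ε := by
        calc ‖ι (H (g σ))‖ ≤ B₀ * ‖g σ‖ := (hι _).trans (hH _)
          _ ≤ B₀ * (4 * C₂ * ε ^ 2) := mul_le_mul_of_nonneg_left hgσ hB₀
          _ = (4 * C₂ * B₀ * ε) * ε := by ring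
          _ ≤ 1 * ε := mul_le_mul_of_nonneg_right hR2 hε.le
          _ = ε := one_mul ε
      rw [mem_ball_zero_iff]
      calc ‖ι (Y σ) - ι (H (g σ))‖ ≤ ‖ι (Y σ)‖ + ‖ι (H (g σ))‖ := norm_sub_le _ _
        _ < ε + ε := add_lt_add_of_lt_of_le (hA σ hσ) hHg
        _ ≤ R := by linarith
    exact hCd.comp hinner hinto
  exact analytic_fixedPoint_113 (quadAnalytic_of_frechet hCq hCd) hC₂ hB₀ hV
    (Hσ := fun _ => ((ι.comp H : 𝒳 →L[ℂ] 𝒴') : 𝒳 →ₗ[ℂ] 𝒴')) (Aσ := fun σ => ι (Y σ)) hHop hA hq hRC han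

omit [NormedAddCommGroup 𝒵] [NormedSpace ℂ 𝒵] in
/-- **THE LANDAU CORRECTION IS A (JOINTLY) HOLOMORPHIC FUNCTION OF FINITELY MANY COMPLEX PARAMETERS.**  Under (44)+[4]
Prop. 7 `hCq`/`hCd`, the scaling `hι`, (46) `hH`, the (54)-smallness `9C₂B₀ε < 1`, `3ε ≤ R`: for `Y` holomorphic on
an open `U ⊆ ℂᵐ` with `‖Y z‖ < ε`, `z ↦ corrAt C ι H (4C₂ε²) (Y z)` is complex differentiable on `U` — Osgood's lemma
from `ShellMeasureLandauHolonomyContinuity.continuousOn_corrAt` and `landauCorrection_on` on the coordinate slices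
(«the fixed point is an analytic function of A′», [Balaban1985Variational] p. 286 / B13 p. 5, joint form). [folklore] -/
theorem differentiableOn_corrAt {C : 𝒴' → 𝒳} {C₂ R : ℝ} (hC₂ : 0 ≤ C₂)
    (hCq : ∀ Z : 𝒴', ‖Z‖ < R → ‖C Z‖ ≤ C₂ * ‖Z‖ ^ 2) (hCd : DifferentiableOn ℂ C (ball 0 R))
    (ι : 𝒴 →L[ℂ] 𝒴') (hι : ∀ Y, ‖ι Y‖ ≤ ‖Y‖) (H : 𝒳 →L[ℂ] 𝒴) {B₀ : ℝ} (hB₀ : 0 ≤ B₀)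
    (hH : ∀ X, ‖H X‖ ≤ B₀ * ‖X‖) {ε : ℝ} (hq : 9 * C₂ * B₀ * ε < 1) (hRC : 3 * ε ≤ R)
    {m : ℕ} {U : Set (Fin m → ℂ)} (hU : IsOpen U) {Y : (Fin m → ℂ) → 𝒴} (hYd : DifferentiableOn ℂ Y U)
    (hY : ∀ z ∈ U, ‖Y z‖ < ε) :
    DifferentiableOn ℂ (fun z => corrAt C ι H (4 * C₂ * ε ^ 2) (Y z)) U := by
  refine differentiableOn_of_continuousOn_of_differentiableOn_update hU ?_ fun z _ i => ?_
  · have h := (continuousOn_corrAt hC₂ hCq hCd ι hι H hB₀ hH hq hRC).comp hYd.continuousOn fun z hz => hY z hz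
    exact h
  · obtain ⟨hV, hupd⟩ := slice_open_differentiable hU z i
    have hYd' : DifferentiableOn ℂ (fun t => Y (Function.update z i t)) {t : ℂ | Function.update z i t ∈ U} :=
      hYd.comp hupd.differentiableOn fun t ht => ht
    obtain ⟨Dc, hDd, hD⟩ := landauCorrection_on hC₂ hCq hCd ι hι H hB₀ hH hq hRC hV hYd' fun t ht => hY _ ht
    refine hDd.congr fun t ht => ?_
    exact corrAt_eq_of_unique (hD t ht).1 (hD t ht).2.1 (hD t ht).2.2.1

omit [NormedAddCommGroup 𝒵] [NormedSpace ℂ 𝒵] in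
/-- **THE LANDAU EXPONENT `Ψ̂(Y) = Y − H D(Y)` IS JOINTLY HOLOMORPHIC** along a holomorphic `Y` on an open `U ⊆ ℂᵐ` with
`‖Y z‖ < ε` (same binders). [folklore] -/
theorem differentiableOn_landauExp {C : 𝒴' → 𝒳} {C₂ R : ℝ} (hC₂ : 0 ≤ C₂)
    (hCq : ∀ Z : 𝒴', ‖Z‖ < R → ‖C Z‖ ≤ C₂ * ‖Z‖ ^ 2) (hCd : DifferentiableOn ℂ C (ball 0 R))
    (ι : 𝒴 →L[ℂ] 𝒴') (hι : ∀ Y, ‖ι Y‖ ≤ ‖Y‖) (H : 𝒳 →L[ℂ] 𝒴) {B₀ : ℝ} (hB₀ : 0 ≤ B₀)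
    (hH : ∀ X, ‖H X‖ ≤ B₀ * ‖X‖) {ε : ℝ} (hq : 9 * C₂ * B₀ * ε < 1) (hRC : 3 * ε ≤ R)
    {m : ℕ} {U : Set (Fin m → ℂ)} (hU : IsOpen U) {Y : (Fin m → ℂ) → 𝒴} (hYd : DifferentiableOn ℂ Y U)
    (hY : ∀ z ∈ U, ‖Y z‖ < ε) :
    DifferentiableOn ℂ (fun z => landauExp C ι H (4 * C₂ * ε ^ 2) (Y z)) U :=
  hYd.sub (H.differentiable.comp_differentiableOn (differentiableOn_corrAt hC₂ hCq hCd ι hι H hB₀ hH hq hRC hU hYd hY))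

end Corr

/-! ## §3 Words of exponentials of a holomorphic exponent field -/

section Hol

variable {E : Type*} [NormedAddCommGroup E] [NormedSpace ℂ E]
  {A : Type*} [NormedRing A] [NormedAlgebra ℂ A] [CompleteSpace A]

/-- the exponential of a complete normed `ℂ`-algebra is entire. [folklore] -/
theorem differentiable_expA : Differentiable ℂ (exp : A → A) :=
  fun x => (NormedSpace.exp_analytic (𝕂 := ℂ) x).differentiableAt

omit [NormedAddCommGroup 𝒴'] [NormedSpace ℂ 𝒴'] [NormedAddCommGroup 𝒳] [NormedSpace ℂ 𝒳] [NormedAddCommGroup 𝒵]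
  [NormedSpace ℂ 𝒵] in
/-- the word of exponentials of the read-outs of a holomorphic exponent field is holomorphic. [folklore] -/
theorem differentiableOn_wordExp_map {s : Set E} {Z : E → 𝒴} (hZ : DifferentiableOn ℂ Z s) :
    ∀ ℓs : List (𝒴 →L[ℂ] A), DifferentiableOn ℂ (fun y => wordExp (ℓs.map fun ℓ => ℓ (Z y))) s
  | [] => by simpa only [List.map_nil, wordExp_nil] using differentiableOn_const (1 : A)
  | ℓ :: ℓs => by
      have h1 : DifferentiableOn ℂ (fun y => exp (ℓ (Z y))) s :=
        differentiable_expA.comp_differentiableOn (ℓ.differentiable.comp_differentiableOn hZ)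
      have h2 : DifferentiableOn ℂ (fun y => exp (ℓ (Z y)) * wordExp (ℓs.map fun ℓ => ℓ (Z y))) s :=
        h1.mul (differentiableOn_wordExp_map hZ ℓs)
      simpa only [List.map_cons, wordExp_cons] using h2

omit [NormedAddCommGroup 𝒴'] [NormedSpace ℂ 𝒴'] [NormedAddCommGroup 𝒳] [NormedSpace ℂ 𝒳] [NormedAddCommGroup 𝒵]
  [NormedSpace ℂ 𝒵] in
/-- **`holOf ℓs Z` IS HOLOMORPHIC WHERE THE EXPONENT FIELD `Z` IS.** [folklore] -/
theorem differentiableOn_holOf {s : Set E} {Z : E → 𝒴} (hZ : DifferentiableOn ℂ Z s) (ℓs : List (𝒴 →L[ℂ] A)) :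
    DifferentiableOn ℂ (holOf ℓs Z) s :=
  differentiableOn_wordExp_map hZ ℓs

end Hol

/-! ## §4 The holonomy field of `ShellMeasureLandauHolonomyChart` §3 is holomorphic on the polydisc -/

section Polydisc

variable {n : ℕ} {ℬ : Type*} [NormedAddCommGroup ℬ] [NormedSpace ℂ ℬ] [CompleteSpace 𝒴] [CompleteSpace 𝒳]
  {A : Type*} [NormedRing A] [NormedAlgebra ℂ A] [CompleteSpace A]
  {𝒢 : 𝒵 →L[ℂ] 𝒴} {W𝒱 : 𝒴 → 𝒵} {B₀ C₄ a₃ : ℝ}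

/-- **THE DEFINED LANDAU HOLONOMY IS A HOLOMORPHIC FUNCTION OF THE COMPLEXIFIED CHART POINT ON THE POLYDISC.**  Under
the data binders of `ShellMeasureLandauHolonomyChart.hAN_landau_chartRay` ((P2) `h𝒢`; (P4) `hW`; the numbers
(118)/(121) at `(j, θ, a) = (0, 0, B₀b)`; (103) `hH₁`; `Φ` holomorphic on the polydisc `‖z‖ < r_Φ` with `‖Φ z‖ < b`
((75) TYPE); (44)+[4] Prop. 7 `hCq`/`hCd`; scaling `hι`; (46) `hH`; (54)-smallness at `ε₄ + B₀b`) and for ANY read-out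
list `ℓs`, the field `z ↦ holOf ℓs (w ↦ landauExp C ι H (4C₂(ε₄+B₀b)²) (solAt 𝒢 0 W𝒱 ε₄ 0 (H₁ (Φ w)) + H₁ (Φ w))) z` is
complex (Fréchet-)differentiable on `ball 0 r_Φ` — §1 ∘ §2 ∘ §3.  The (1.31)/(2.17)-TYPE analyticity «the block
configuration is analytic in the complexified field on the window's polydisc», for OUR defined object; Bałaban's
minimiser is not touched (every analytic input stays a binder). [folklore] -/
theorem differentiableOn_landauHol_polydisc
    (h𝒢 : ∀ f, ‖𝒢 f‖ ≤ B₀ * ‖f‖) (hW : Prop4Hyp W𝒱 C₄ a₃) (hB₀ : 0 < B₀) (hC₄ : 0 ≤ C₄)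
    {b ε₄ : ℝ} (hε₄ : 0 ≤ ε₄) (hdom : 2 * (ε₄ + B₀ * b) ≤ a₃)
    (hself : B₀ * C₄ * (ε₄ + B₀ * b) ^ 2 ≤ ε₄) (hcontr : 4 * B₀ * C₄ * (ε₄ + B₀ * b) < 1)
    (H₁ : ℬ →L[ℂ] 𝒴) (hH₁ : ∀ B, ‖H₁ B‖ ≤ B₀ * ‖B‖)
    {Φ : (Fin n → ℂ) → ℬ} {rΦ : ℝ} (hΦd : DifferentiableOn ℂ Φ (ball 0 rΦ))
    (hΦ : ∀ z ∈ ball (0 : Fin n → ℂ) rΦ, ‖Φ z‖ < b)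
    {C : 𝒴' → 𝒳} {C₂ R : ℝ} (hC₂ : 0 ≤ C₂) (hCq : ∀ Z : 𝒴', ‖Z‖ < R → ‖C Z‖ ≤ C₂ * ‖Z‖ ^ 2)
    (hCd : DifferentiableOn ℂ C (ball 0 R)) (ι : 𝒴 →L[ℂ] 𝒴') (hι : ∀ Y, ‖ι Y‖ ≤ ‖Y‖) (H : 𝒳 →L[ℂ] 𝒴)
    (hH : ∀ X, ‖H X‖ ≤ B₀ * ‖X‖) (hq : 9 * C₂ * B₀ * (ε₄ + B₀ * b) < 1) (hRC : 3 * (ε₄ + B₀ * b) ≤ R)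
    (ℓs : List (𝒴 →L[ℂ] A)) :
    DifferentiableOn ℂ (holOf ℓs (fun z : Fin n → ℂ => landauExp C ι H (4 * C₂ * (ε₄ + B₀ * b) ^ 2)
      (solAt 𝒢 0 W𝒱 ε₄ (0 : 𝒵) (H₁ (Φ z)) + H₁ (Φ z)))) (ball 0 rΦ) := by
  -- the coarse datum on the polydisc and its size
  have hdat : DifferentiableOn ℂ (fun z : Fin n → ℂ => H₁ (Φ z)) (ball 0 rΦ) :=
    H₁.differentiable.comp_differentiableOn hΦd
  have hsz : ∀ z ∈ ball (0 : Fin n → ℂ) rΦ, ‖H₁ (Φ z)‖ < B₀ * b := fun z hz =>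
    (hH₁ _).trans_lt (mul_lt_mul_of_pos_left (hΦ z hz) hB₀)
  -- §1: the canonical solution is holomorphic in the data (Λ = 0, J ≡ 0)
  have hΛ : ∀ Y : 𝒴, ‖(0 : 𝒴 →L[ℂ] 𝒴) Y‖ ≤ 0 * ‖Y‖ := fun Y => by
    rw [zero_apply, norm_zero, zero_mul]
  have hself' : B₀ * 0 + 0 * (ε₄ + B₀ * b) + B₀ * C₄ * (ε₄ + B₀ * b) ^ 2 ≤ ε₄ := by
    rw [mul_zero, zero_mul, zero_add, zero_add]; exact hself
  have hcontr' : 0 + 4 * B₀ * C₄ * (ε₄ + B₀ * b) < 1 := by rw [zero_add]; exact hcontr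
  have hJ0 : ‖(0 : 𝒵)‖ ≤ 0 := norm_zero.le
  have hsol : DifferentiableOn ℂ (fun z : Fin n → ℂ => solAt 𝒢 0 W𝒱 ε₄ (0 : 𝒵) (H₁ (Φ z))) (ball 0 rΦ) :=
    differentiableOn_solAt h𝒢 hΛ hW hB₀.le hC₄ le_rfl hε₄ hdom hself' hcontr' isOpen_ball
      (differentiableOn_const (0 : 𝒵)) hdat (fun _ _ => hJ0) hsz
  -- the curve `Y = X + 𝔄` stays in `‖Y‖ < ε₄ + B₀ b`
  have hY : DifferentiableOn ℂ (fun z : Fin n → ℂ => solAt 𝒢 0 W𝒱 ε₄ (0 : 𝒵) (H₁ (Φ z)) + H₁ (Φ z)) (ball 0 rΦ) :=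
    hsol.add hdat
  have hYlt : ∀ z ∈ ball (0 : Fin n → ℂ) rΦ, ‖solAt 𝒢 0 W𝒱 ε₄ (0 : 𝒵) (H₁ (Φ z)) + H₁ (Φ z)‖ < ε₄ + B₀ * b := by
    intro z hz
    have hex : ∃ X : 𝒴, ‖X‖ ≤ ε₄ ∧ mapT 𝒢 0 W𝒱 (0 : 𝒵) (H₁ (Φ z)) X = X :=
      (existsUnique_solution h𝒢 hΛ hW.quadAnalytic hB₀.le hC₄ le_rfl hJ0 (hsz z hz) hε₄ hdom hself'
        hcontr').exists
    exact norm_arg_lt (hsz z hz) (solAt_spec hex).1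
  -- §2 + §3
  have hZ := differentiableOn_landauExp hC₂ hCq hCd ι hι H hB₀.le hH hq hRC isOpen_ball hY hYlt
  exact differentiableOn_holOf hZ ℓs

omit [NormedSpace ℂ ℬ] [CompleteSpace 𝒴] [CompleteSpace 𝒳] [CompleteSpace A] in
/-- the real-chart holonomy of `ShellMeasureLandauHolonomyChart` §3 is the restriction of the polydisc field along
`cplx` (definitional). [folklore] -/
theorem landauHol_chart_eq (ℓs : List (𝒴 →L[ℂ] A)) (Z : (Fin n → ℂ) → 𝒴) :
    holOf ℓs (fun y : Fin n → ℝ => Z (cplx y)) = holOf ℓs Z ∘ cplx := rfl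

end Polydisc

end Summit.QuantumFields.BalabanUV.T4Continuum.ShellMeasureLandauHolonomyAnalytic
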